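import Mathlib
import HarnessLib
import Literature.MathematicalPhysics.StatisticalMechanics.RenormalisationMap
import Literature.MathematicalPhysics.StatisticalMechanics.RenormalisationStepAlgebra

/-!
# The renormalisation map `K_{k+1} = S_k(H,K)` in the reblocked-sum form of [ABKM19] Ch. 9.1:
# `K_{k+1}(U,φ) = Σ_{X : π(X)=U} Σ_{X₁⊆X} (e^{−H̃})^{U∖X} (e^{H̃})^{X∖U} (1−e^{−H̃})^{X₁} · R_{k+1}[P₂(e^{−H},K)(X∖X₁)](φ)`

[ABKM19] (6.34) defines `K_{k+1}(U) = Σ_{π(X)=U} Ĩ^{U∖X} (Ĩ^{X∖U})^{−1} ∫ Φ(X,φ,ξ) μ_{k+1}(dξ)` with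
`Φ = (J̃ ∘ ((I − 1) ∘ K))(X)`; Ch. 9.1 rewrites it through the maps `E`, `P₁`, `P₂`, `P₃`, `R₁`, `R₂`.
This file performs that rewriting in the tree's vocabulary (`nextKStep`, `midK`, `fluct`): the inverse
`(e^{−H̃})^{−(X∖U)}` is the block product of `e^{+H̃} = e^{−(−H̃)}`, the circle product inside `Φ` is
the polynomial map `P₂`, and the fluctuation integral is pulled through the finite sums.

* `polyP2 s H K Z ψ` — `P₂(e^{−H}, K)(Z, ψ) = Σ_{Y ∈ 𝓟_s(Z)} (e^{−H} − 1)^{Z∖Y}(ψ) K(Y, ψ)`;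
* `polyP2_eq_pcirc` — `= ((e^{−H} − 1)^∘ ∘ K)(Z)`;
* `bprod_expNegH_neg_mul` — `(e^{H̃})^{Z} (e^{−H̃})^{Z} = 1`;
* `integral_midK_eq_sum` — `∫ Φ(X,φ,ξ) dμ = Σ_{X₁⊆X} (1 − Ĩ)^{X₁}(φ) · R[P₂(X∖X₁)](φ)`;
* **`nextKStep_eq_sum`** — the displayed reblocked double sum.

Everything is proved; no named fact.

## References
* S. Adams, S. Buchholz, R. Kotecký, S. Müller, arXiv:1910.13564, Definition 6.5 (6.34), Ch. 9.1
  (decomposition of `S`, the maps `P₁`, `P₂`, `R₁`) [AdamsBuchholzKoteckyMuller2019].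
-/

noncomputable section

namespace Literature.MathematicalPhysics.StatisticalMechanics.GradientRG

open scoped BigOperators Classical
open Finset MeasureTheory
open Literature.MathematicalPhysics.StatisticalMechanics.TorusPolymer
  (IsPolymer blocks polys pcirc bprod reblock mem_polys pcirc_comm bprod_mul_bprod_eq_one isPolymer_univ)

variable {d M : ℕ} [NeZero M]

/-- **`P₂(e^{−H}, K)(Z, ψ) = Σ_{Y ∈ 𝓟_s(Z)} (e^{−H} − 1)^{Z∖Y}(ψ) K(Y, ψ)`** ([ABKM19] Ch. 9.1, the map
`P₂(I,K) = (I − 1) ∘ K` at `I = e^{−H}`). [cite: AdamsBuchholzKoteckyMuller2019, Ch. 9.1 (the map P₂)] -/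
def polyP2 (s : ℕ) (H : RelevantHamiltonian ℂ d) (K : Finset (Fin d → ZMod M) → ((Fin d → ZMod M) → ℝ) → ℂ)
    (Z : Finset (Fin d → ZMod M)) (ψ : (Fin d → ZMod M) → ℝ) : ℂ :=
  ∑ Y ∈ polys s Z, bprod s (fun B => expNegH H B ψ - 1) (Z \ Y) * K Y ψ

/-- `P₂(e^{−H},K)(Z, ψ) = ((e^{−H(·,ψ)} − 1)^∘ ∘ K(·,ψ))(Z)` for an `s`-polymer `Z`.
[cite: AdamsBuchholzKoteckyMuller2019, Ch. 9.1 (the map P₂)] -/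
theorem polyP2_eq_pcirc (s : ℕ) (H : RelevantHamiltonian ℂ d)
    (K : Finset (Fin d → ZMod M) → ((Fin d → ZMod M) → ℝ) → ℂ) {Z : Finset (Fin d → ZMod M)}
    (hZ : IsPolymer s Z) (ψ : (Fin d → ZMod M) → ℝ) :
    polyP2 s H K Z ψ = pcirc s (bprod s fun B => expNegH H B ψ - 1) (fun Y => K Y ψ) Z := by
  rw [polyP2, TorusPolymer.pcirc_apply_symm _ _ hZ]

/-- `(e^{H̃})^{Z}(φ) · (e^{−H̃})^{Z}(φ) = 1` (`e^{H̃(B)} = e^{−(−H̃)(B)}`).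
[cite: AdamsBuchholzKoteckyMuller2019, Ch. 9.1 ("I₁ = I₂⁻¹")] -/
theorem bprod_expNegH_neg_mul (s : ℕ) (H : RelevantHamiltonian ℂ d) (Z : Finset (Fin d → ZMod M))
    (φ : (Fin d → ZMod M) → ℝ) :
    bprod s (fun B => expNegH (-H) B φ) Z * bprod s (fun B => expNegH H B φ) Z = 1 := by
  refine bprod_mul_bprod_eq_one fun B _ => ?_
  have hneg : eval (-H) B φ = -(eval H B φ) := by
    have h := eval_add H (-H) B φ
    rw [add_neg_cancel, eval_zero] at h
    exact eq_neg_of_add_eq_zero_right h.symm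
  simp only [expNegH, hneg, neg_neg, ← Complex.exp_add, add_neg_cancel, Complex.exp_zero]

/-- `(e^{−H̃})^{Z}(φ)⁻¹ = (e^{H̃})^{Z}(φ)`. [cite: AdamsBuchholzKoteckyMuller2019, Ch. 9.1 ("I₁ = I₂⁻¹")] -/
theorem bprod_expNegH_inv (s : ℕ) (H : RelevantHamiltonian ℂ d) (Z : Finset (Fin d → ZMod M))
    (φ : (Fin d → ZMod M) → ℝ) :
    (bprod s (fun B => expNegH H B φ) Z)⁻¹ = bprod s (fun B => expNegH (-H) B φ) Z :=
  (eq_inv_of_mul_eq_one_left (bprod_expNegH_neg_mul s H Z φ)).symm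

/-- **`∫ Φ(X,φ,ξ) μ(dξ) = Σ_{X₁ ∈ 𝓟_s(X)} (1 − Ĩ)^{X₁}(φ) · ∫ P₂(e^{−H},K)(X∖X₁, φ+ξ) μ(dξ)`** for an
`s`-polymer `X`, when each `P₂(Z, φ + ·)` (`Z` an `s`-polymer) is integrable.
[cite: AdamsBuchholzKoteckyMuller2019, Ch. 9.1 (S = P₁(…, R₁(P₃(P₂(E(−H),K)))))] -/
theorem integral_midK_eq_sum {s : ℕ} (H : RelevantHamiltonian ℂ d)
    (It K : Finset (Fin d → ZMod M) → ((Fin d → ZMod M) → ℝ) → ℂ) (μ : Measure ((Fin d → ZMod M) → ℝ))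
    {X : Finset (Fin d → ZMod M)} (hX : IsPolymer s X) (φ : (Fin d → ZMod M) → ℝ)
    (hint : ∀ Z, IsPolymer s Z → Integrable (fun ξ => polyP2 s H K Z (φ + ξ)) μ) :
    ∫ ξ, midK s (expNegH H) It K X φ ξ ∂μ =
      ∑ X₁ ∈ polys s X, bprod s (fun B => 1 - It B φ) X₁ * ∫ ξ, polyP2 s H K (X \ X₁) (φ + ξ) ∂μ := by
  have hmid : ∀ ξ, midK s (expNegH H) It K X φ ξ =
      ∑ X₁ ∈ polys s X, bprod s (fun B => 1 - It B φ) X₁ * polyP2 s H K (X \ X₁) (φ + ξ) := by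
    intro ξ
    unfold midK
    rw [TorusPolymer.pcirc]
    refine Finset.sum_congr rfl fun X₁ hX₁ => ?_
    rw [polyP2_eq_pcirc s H K (hX.sdiff (mem_polys.1 hX₁).2)]
  simp_rw [hmid]
  rw [integral_finsetSum]
  · exact Finset.sum_congr rfl fun X₁ _ => integral_const_mul _ _
  · intro X₁ hX₁
    exact (hint _ (hX.sdiff (mem_polys.1 hX₁).2)).const_mul _

/-- **The reblocked form of `K_{k+1}`** ([ABKM19] Ch. 9.1): with `H̃ = H_{k+1}` (`nextH D H K`),
`K_{k+1}(U, φ) = Σ_{X ∈ 𝓟_k, π(X) = U} Σ_{X₁ ∈ 𝓟_k(X)} (e^{−H̃})^{U∖X}(φ) (e^{H̃})^{X∖U}(φ)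
  · ((1 − e^{−H̃})^{X₁}(φ) · R_{k+1}[P₂(e^{−H},K)(X∖X₁)](φ))`,
provided each `P₂(Z, φ + ·)` (`Z ∈ 𝓟_k`) is `μ_{k+1}`-integrable.
[cite: AdamsBuchholzKoteckyMuller2019, Ch. 9.1 (S = P₁(E(−R₂), E(R₂), 1 − E(−R₂), R₁(P₃(P₂(E(−H),K)))))] -/
theorem nextKStep_eq_sum (D : StepData d M) (H : RelevantHamiltonian ℂ d)
    (K : Finset (Fin d → ZMod M) → ((Fin d → ZMod M) → ℝ) → ℂ) (U : Finset (Fin d → ZMod M))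
    (φ : (Fin d → ZMod M) → ℝ)
    (hint : ∀ Z, IsPolymer D.s Z → Integrable (fun ξ => polyP2 D.s H K Z (φ + ξ)) (stepMeasure D.𝒞)) :
    nextKStep D H K U φ =
      ∑ X ∈ (polys D.s univ).filter (fun X => reblock D.s (D.L * D.s) X = U), ∑ X₁ ∈ polys D.s X,
        bprod D.s (fun B => expNegH (nextH D H K) B φ) (U \ X) *
          bprod D.s (fun B => expNegH (-(nextH D H K)) B φ) (X \ U) *
          (bprod D.s (fun B => 1 - expNegH (nextH D H K) B φ) X₁ *
            fluct D.𝒞 (polyP2 D.s H K (X \ X₁)) φ) := by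
  unfold nextKStep nextK
  refine Finset.sum_congr rfl fun X hX => ?_
  have hXp : IsPolymer D.s X := (mem_polys.1 (mem_filter.1 hX).1).2
  rw [bprod_expNegH_inv, integral_midK_eq_sum H _ K _ hXp φ hint, Finset.mul_sum]
  rfl

end Literature.MathematicalPhysics.StatisticalMechanics.GradientRG

end
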